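import Mathlib
import Summits.ValiantsHypothesis.ValiantsHypothesis.Theorems.NewtonUnitEquationsTwoProductsPencil
/-! # Stub `stub_resonanceDichotomy` — crux `TwoProducts` (stmt-ValiantsHypothesis-5906), line `corner-log-linearization`
   The RESONANCE DICHOTOMY of the net normal form in general rank.  Let `F_1, …, F_r` be
   constant-free bivariate polynomials with LEXICOGRAPHIC pivots `p_ρ` for a weight `w` with
   `w₁ ≠ 0` (`p_ρ` is the strict minimiser of `(wt_w, x)` on `supp F_ρ`), and let
   `D = ∏ (1 + ∑_ρ a_{iρ} F_ρ) - ∏ (1 + ∑_ρ a'_{iρ} F_ρ) = P(F)` for the net polynomial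
   `P = ∏ (1 + ∑_ρ a_{iρ} X_ρ) - ∏ (1 + ∑_ρ a'_{iρ} X_ρ)` of total degree `≤ n`, so that
   `D = ∑_{s ∈ supp P} P_s • ∏_ρ F_ρ ^ s_ρ` and `∑_ρ s_ρ ≤ n` on `supp P`.  Perturb `w` to the
   additive integer weight `ω = K • wt_w + x` with `K` exceeding the `x`-coordinate of the vertex,
   of every pivot, and `n •` every pivot.  Then each `p_ρ` is the strict `ω`-minimiser of
   `supp F_ρ`, strict minimisers multiply, so `φ s = ∑_ρ s_ρ • p_ρ` is the strict `ω`-minimiser of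
   `supp ∏_ρ F_ρ ^ s_ρ`, and `ω` is injective on the points `φ s`, `s ∈ supp P` (`K`-separation).
   DICHOTOMY: either `φ` is injective on `supp P` — then the unique `ω ∘ φ`-minimiser `s⋆ ∈ supp P`
   makes `φ s⋆` the strict `ω`-minimiser of `supp D`, and since `ω` refines `wt_w` strictly on
   `supp D` every strict `wt_w`-minimiser `e` of `supp D` equals `φ s⋆ = ∑ s⋆_ρ • p_ρ`,
   `∑ s⋆_ρ ≤ n` (NET-FIRST-ORDER); or two exponents `s ≠ s'` of `supp P` have `φ s = φ s'`, and
   `Δ = s - s'` is an ADDITIVE RESONANCE of the pivots: `Δ ≠ 0`, `∑ |Δ_ρ| ≤ 2n`,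
   `∑ Δ_ρ p_ρ = 0` in `ℤ²`. [folklore] -/
set_option linter.dupNamespace false -- single-conjunct summit: `ValiantsHypothesis.ValiantsHypothesis`
namespace Summit.ValiantsHypothesis.ValiantsHypothesis.Theorems.TwoProducts.ResonanceDichotomy
open scoped BigOperators
open MvPolynomial
open Summit.ValiantsHypothesis.ValiantsHypothesis.Theorems.TwoProducts.Pencil

/-- The perturbed weight `ω = K • wt_w + x` (`w 1 ≠ 0`) is injective on exponents whose
`x`-coordinates are `< K`: a tie forces the `wt`-parts to agree (`K`-separation), then the
`x`-coordinates, then the `y`-coordinates. [folklore] -/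
-- adapted from NetTransversal (`exists_strictMin`)
theorem eq_of_wt_eq (K : ℤ) (w : Fin 2 → ℤ) (hw1 : w 1 ≠ 0) (ω : (Fin 2 →₀ ℕ) → ℤ)
    (hω : ∀ q, ω q = K * (w 0 * (q 0 : ℤ) + w 1 * (q 1 : ℤ)) + (q 0 : ℤ))
    (v p : Fin 2 →₀ ℕ) (hvK : ((v 0 : ℕ) : ℤ) < K) (hpK : ((p 0 : ℕ) : ℤ) < K)
    (heq : ω v = ω p) : v = p := by
  rw [hω, hω] at heq
  have hwt : w 0 * (v 0 : ℤ) + w 1 * (v 1 : ℤ) = w 0 * (p 0 : ℤ) + w 1 * (p 1 : ℤ) := by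
    by_contra hne
    rcases lt_or_gt_of_ne hne with hlt | hlt
    · exact absurd heq (K_separates (Nat.cast_nonneg _) hvK (Nat.cast_nonneg _) hlt).ne
    · exact absurd heq.symm (K_separates (Nat.cast_nonneg _) hpK (Nat.cast_nonneg _) hlt).ne
  have hx0 : ((p 0 : ℕ) : ℤ) = v 0 := by rw [hwt] at heq; linarith
  have hx1 : ((p 1 : ℕ) : ℤ) = v 1 := by
    rw [← hx0] at hwt
    have h2 : w 1 * ((p 1 : ℕ) : ℤ) = w 1 * (v 1 : ℤ) := by linarith
    exact mul_left_cancel₀ hw1 h2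
  ext i
  fin_cases i
  · exact_mod_cast hx0.symm
  · exact_mod_cast hx1.symm

/-- Strict minimisers of an additive weight multiply over a finite product: if `v i` is the unique
`ω`-lightest support point of `G i` for every `i ∈ σ`, then `∑_{i ∈ σ} v i` is the unique
`ω`-lightest support point of `∏_{i ∈ σ} G i`. [folklore] -/
theorem strictMin_finsetProd (ω : (Fin 2 →₀ ℕ) → ℤ) (hadd : ∀ p q, ω (p + q) = ω p + ω q)
    {ι : Type*} [DecidableEq ι] (σ : Finset ι) (G : ι → MvPolynomial (Fin 2) ℂ)
    (v : ι → (Fin 2 →₀ ℕ))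
    (hv : ∀ i ∈ σ, v i ∈ (G i).support ∧ ∀ q ∈ (G i).support, q ≠ v i → ω (v i) < ω q) :
    (∑ i ∈ σ, v i) ∈ (∏ i ∈ σ, G i).support ∧
      ∀ q ∈ (∏ i ∈ σ, G i).support, q ≠ ∑ i ∈ σ, v i → ω (∑ i ∈ σ, v i) < ω q := by
  classical
  induction σ using Finset.induction_on with
  | empty =>
    refine ⟨?_, ?_⟩
    · rw [Finset.sum_empty, Finset.prod_empty, mem_support_iff, coeff_zero_one]
      exact one_ne_zero
    · intro q hq hne
      rw [Finset.prod_empty, mem_support_iff, coeff_one] at hq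
      split_ifs at hq with h'
      · exact absurd (by rw [← h', Finset.sum_empty]) hne
      · exact absurd rfl hq
  | insert i σ hi ih =>
    obtain ⟨hmem, hmin⟩ := ih fun j hj => hv j (Finset.mem_insert_of_mem hj)
    obtain ⟨hvi, hvimin⟩ := hv i (Finset.mem_insert_self i σ)
    obtain ⟨-, hmem', hmin'⟩ :=
      strictMin_mul ω hadd (G i) (∏ j ∈ σ, G j) (v i) (∑ j ∈ σ, v j) hvi hvimin hmem hmin
    rw [Finset.prod_insert hi, Finset.sum_insert hi]
    exact ⟨hmem', hmin'⟩

/-- Exponents of the net polynomial `P = ∏ (1 + ∑_ρ a_{iρ} X_ρ) - ∏ (1 + ∑_ρ a'_{iρ} X_ρ)` have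
coordinate sum at most `n` (its total degree is at most `n`). [folklore] -/
theorem sum_le_of_mem_support_net (n r : ℕ) (a a' : Fin n → Fin r → ℂ)
    (P : MvPolynomial (Fin r) ℂ)
    (hP : P = (∏ i, (1 + ∑ ρ, C (a i ρ) * X ρ)) - ∏ i, (1 + ∑ ρ, C (a' i ρ) * X ρ))
    (s : Fin r →₀ ℕ) (hs : s ∈ P.support) : (∑ ρ, s ρ) ≤ n := by
  have hfac : ∀ c : Fin r → ℂ,
      (1 + ∑ ρ, C (c ρ) * X ρ : MvPolynomial (Fin r) ℂ).totalDegree ≤ 1 := by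
    intro c
    refine (totalDegree_add _ _).trans (max_le (by simp [totalDegree_one]) ?_)
    refine (totalDegree_finsetSum _ _).trans (Finset.sup_le fun ρ _ => ?_)
    exact (totalDegree_mul _ _).trans (by simp [totalDegree_C, totalDegree_X])
  have hprod : ∀ c : Fin n → Fin r → ℂ,
      (∏ i, (1 + ∑ ρ, C (c i ρ) * X ρ) : MvPolynomial (Fin r) ℂ).totalDegree ≤ n := by
    intro c
    refine (totalDegree_finsetProd _ _).trans ?_
    calc ∑ i, (1 + ∑ ρ, C (c i ρ) * X ρ : MvPolynomial (Fin r) ℂ).totalDegree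
        ≤ ∑ _i : Fin n, 1 := Finset.sum_le_sum fun i _ => hfac (c i)
      _ = n := by simp
  have hdeg : P.totalDegree ≤ n := by
    rw [hP]
    exact (totalDegree_sub _ _).trans (max_le (hprod a) (hprod a'))
  have h1 := le_totalDegree hs
  rw [Finsupp.sum_fintype _ _ (fun _ => rfl)] at h1
  exact h1.trans hdeg

/-- **Core of the resonance dichotomy.** Let the `F ρ` have lexicographic pivots `p ρ` for a weight
`w` with `w 1 ≠ 0`, let every exponent of `P` have coordinate sum `≤ n`, and let
`D = ∑_{s ∈ supp P} P_s • ∏_ρ F_ρ ^ s_ρ`.  Then for every strict `wt_w`-minimiser `e` of `supp D`: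
either `e = ∑_ρ s_ρ • p_ρ` for some `s ∈ supp P`, or two distinct exponents `s ≠ s'` of `P` have
`∑_ρ s_ρ • p_ρ = ∑_ρ s'_ρ • p_ρ`. [folklore] -/
theorem vertex_dichotomy {r : ℕ} (n : ℕ) (F : Fin r → MvPolynomial (Fin 2) ℂ)
    (p : Fin r → (Fin 2 →₀ ℕ)) (P : MvPolynomial (Fin r) ℂ) (D : MvPolynomial (Fin 2) ℂ)
    (hN : ∀ s ∈ P.support, (∑ ρ, s ρ) ≤ n)
    (hD : D = ∑ s ∈ P.support, coeff s P • ∏ ρ, F ρ ^ (s ρ))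
    (w : Fin 2 → ℤ) (hw1 : w 1 ≠ 0)
    (hpiv : ∀ ρ, p ρ ∈ (F ρ).support ∧ ∀ q ∈ (F ρ).support, q ≠ p ρ →
      w 0 * (p ρ 0 : ℤ) + w 1 * (p ρ 1 : ℤ) < w 0 * (q 0 : ℤ) + w 1 * (q 1 : ℤ) ∨
        (w 0 * (p ρ 0 : ℤ) + w 1 * (p ρ 1 : ℤ) = w 0 * (q 0 : ℤ) + w 1 * (q 1 : ℤ) ∧ p ρ 0 < q 0))
    (e : Fin 2 →₀ ℕ) (he : e ∈ D.support)
    (hmin : ∀ e' ∈ D.support, e' ≠ e →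
      w 0 * (e 0 : ℤ) + w 1 * (e 1 : ℤ) < w 0 * (e' 0 : ℤ) + w 1 * (e' 1 : ℤ)) :
    (∃ s ∈ P.support, e = ∑ ρ, s ρ • p ρ) ∨
      ∃ s ∈ P.support, ∃ s' ∈ P.support, s ≠ s' ∧ (∑ ρ, s ρ • p ρ) = ∑ ρ, s' ρ • p ρ := by
  classical
  -- the exponent map `φ s = ∑ ρ, s ρ • p ρ`
  obtain ⟨φ, hφ⟩ : ∃ φ : (Fin r →₀ ℕ) → (Fin 2 →₀ ℕ), ∀ s, φ s = ∑ ρ, s ρ • p ρ :=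
    ⟨_, fun _ => rfl⟩
  have hφ0 : ∀ s : Fin r →₀ ℕ, φ s 0 = ∑ ρ, s ρ * p ρ 0 := by
    intro s
    rw [hφ, Finsupp.finsetSum_apply]
    simp only [Finsupp.smul_apply, smul_eq_mul]
  -- a bound `M` on the relevant `x`-coordinates and the scale `K`
  obtain ⟨M, heM, hpM⟩ : ∃ M : ℕ, e 0 ≤ M ∧ ∀ ρ, p ρ 0 ≤ M := by
    refine ⟨e 0 + ∑ ρ, p ρ 0, le_self_add, fun ρ => le_add_left ?_⟩
    exact Finset.single_le_sum (f := fun ρ => p ρ 0) (fun ρ _ => Nat.zero_le _)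
      (Finset.mem_univ ρ)
  obtain ⟨K, hK⟩ : ∃ K : ℤ, K = (n : ℤ) * M + M + 1 := ⟨_, rfl⟩
  have hnM : (0 : ℤ) ≤ (n : ℤ) * M := mul_nonneg (Nat.cast_nonneg _) (Nat.cast_nonneg _)
  have hKe : ((e 0 : ℕ) : ℤ) < K := by
    have h1 : ((e 0 : ℕ) : ℤ) ≤ M := by exact_mod_cast heM
    linarith
  have hKp : ∀ ρ, ((p ρ 0 : ℕ) : ℤ) < K := by
    intro ρ
    have h1 : ((p ρ 0 : ℕ) : ℤ) ≤ M := by exact_mod_cast hpM ρ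
    linarith
  have hKφ : ∀ s ∈ P.support, ((φ s 0 : ℕ) : ℤ) < K := by
    intro s hs
    have h1 : φ s 0 ≤ n * M := by
      rw [hφ0]
      calc ∑ ρ, s ρ * p ρ 0 ≤ ∑ ρ, s ρ * M :=
            Finset.sum_le_sum fun ρ _ => Nat.mul_le_mul_left _ (hpM ρ)
        _ = (∑ ρ, s ρ) * M := (Finset.sum_mul _ _ _).symm
        _ ≤ n * M := Nat.mul_le_mul_right _ (hN s hs)
    have h2 : ((φ s 0 : ℕ) : ℤ) ≤ (n : ℤ) * M := by exact_mod_cast h1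
    linarith
  -- the perturbed weight
  obtain ⟨ω, hω⟩ : ∃ ω : (Fin 2 →₀ ℕ) → ℤ,
      ∀ q, ω q = K * (w 0 * (q 0 : ℤ) + w 1 * (q 1 : ℤ)) + (q 0 : ℤ) := ⟨_, fun q => rfl⟩
  have hadd : ∀ p q, ω (p + q) = ω p + ω q := by
    intro p q
    simp only [hω, Finsupp.coe_add, Pi.add_apply, Nat.cast_add]
    ring
  -- each pivot `p ρ` is the strict `ω`-minimiser of `supp (F ρ)`
  have hpiv' : ∀ ρ, p ρ ∈ (F ρ).support ∧ ∀ q ∈ (F ρ).support, q ≠ p ρ → ω (p ρ) < ω q := by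
    intro ρ
    refine ⟨(hpiv ρ).1, fun q hq hne => ?_⟩
    rcases (hpiv ρ).2 q hq hne with hlt | ⟨heq, hx⟩
    · rw [hω, hω]
      exact K_separates (Nat.cast_nonneg _) (hKp ρ) (Nat.cast_nonneg _) hlt
    · rw [hω, hω, heq]
      have h1 : ((p ρ 0 : ℕ) : ℤ) < q 0 := by exact_mod_cast hx
      linarith
  -- `φ s` is the strict `ω`-minimiser of `supp (∏ ρ, F ρ ^ s ρ)`
  have hT : ∀ s : Fin r →₀ ℕ, φ s ∈ (∏ ρ, F ρ ^ (s ρ)).support ∧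
      ∀ q ∈ (∏ ρ, F ρ ^ (s ρ)).support, q ≠ φ s → ω (φ s) < ω q := by
    intro s
    rw [hφ]
    exact strictMin_finsetProd ω hadd Finset.univ (fun ρ => F ρ ^ (s ρ)) (fun ρ => s ρ • p ρ)
      fun ρ _ => ⟨(strictMin_pow ω hadd (F ρ) (p ρ) (hpiv' ρ).1 (hpiv' ρ).2 (s ρ)).2.1,
        (strictMin_pow ω hadd (F ρ) (p ρ) (hpiv' ρ).1 (hpiv' ρ).2 (s ρ)).2.2⟩
  have hTle : ∀ (s : Fin r →₀ ℕ) (q : Fin 2 →₀ ℕ), q ∈ (∏ ρ, F ρ ^ (s ρ)).support →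
      ω (φ s) ≤ ω q := fun s q hq =>
    (eq_or_ne q (φ s)).elim (fun h => h ▸ le_rfl) fun h => ((hT s).2 q hq h).le
  -- `supp P` is nonempty, as `D ≠ 0`
  have hPne : P.support.Nonempty := by
    rw [Finset.nonempty_iff_ne_empty]
    intro h
    rw [hD, h, Finset.sum_empty] at he
    simp at he
  -- the dichotomy: is `φ` injective on `supp P`?
  by_cases hinj : ∀ s ∈ P.support, ∀ s' ∈ P.support, φ s = φ s' → s = s'
  swap
  · push Not at hinj
    obtain ⟨s, hs, s', hs', heq, hne⟩ := hinj
    rw [hφ, hφ] at heq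
    exact Or.inr ⟨s, hs, s', hs', hne, heq⟩
  left
  -- the unique `ω ∘ φ`-minimiser `t` of `supp P`
  obtain ⟨t, ht, htle⟩ : ∃ t ∈ P.support, ∀ s ∈ P.support, ω (φ t) ≤ ω (φ s) :=
    Finset.exists_min_image P.support (fun s => ω (φ s)) hPne
  have htmin : ∀ s ∈ P.support, s ≠ t → ω (φ t) < ω (φ s) := by
    intro s hs hst
    refine lt_of_le_of_ne (htle s hs) fun heq => hst ?_
    exact (hinj t ht s hs (eq_of_wt_eq K w hw1 ω hω _ _ (hKφ t ht) (hKφ s hs) heq)).symm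
  -- the coefficient of `D` at `φ t`
  have hcoeff : coeff (φ t) D = coeff t P * coeff (φ t) (∏ ρ, F ρ ^ (t ρ)) := by
    rw [hD, coeff_sum, Finset.sum_eq_single_of_mem t ht]
    · rw [coeff_smul, smul_eq_mul]
    · intro s hs hst
      rw [coeff_smul]
      have h0 : coeff (φ t) (∏ ρ, F ρ ^ (s ρ)) = 0 := by
        by_contra hne
        exact absurd (hTle s _ (mem_support_iff.mpr hne)) (not_le.mpr (htmin s hs hst))
      rw [h0, smul_zero]
  have hmem : φ t ∈ D.support := by
    rw [mem_support_iff, hcoeff]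
    exact mul_ne_zero (mem_support_iff.mp ht) (mem_support_iff.mp (hT t).1)
  have hstrict : ∀ q ∈ D.support, q ≠ φ t → ω (φ t) < ω q := by
    intro q hq hne
    rw [hD] at hq
    obtain ⟨s, hs, hqs⟩ := Finset.mem_biUnion.mp (support_sum hq)
    have hqs' : q ∈ (∏ ρ, F ρ ^ (s ρ)).support := support_smul hqs
    rcases eq_or_ne s t with rfl | hst
    · exact (hT s).2 q hqs' hne
    · exact (htmin s hs hst).trans_le (hTle s q hqs')
  -- `ω` refines `wt_w` strictly on `supp D`, so `e` is the `ω`-minimiser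
  refine ⟨t, ht, ?_⟩
  rw [← hφ]
  by_contra hne
  have h1 := hmin _ hmem (Ne.symm hne)
  have h2 := hstrict e he hne
  have h3 := K_separates (K := K) (Nat.cast_nonneg _) hKe (Nat.cast_nonneg ((φ t) 0)) h1
  rw [hω, hω] at h2
  exact lt_asymm h3 h2

/-- **Resonance dichotomy** (stub `stub_resonanceDichotomy`, registered signature): for
constant-free `F_ρ` with pairwise distinct lexicographic pivots `p_ρ` for a positive weight `w`,
every south-west vertex `e` of `∏ (1 + ∑ a_{iρ} F_ρ) - ∏ (1 + ∑ a'_{iρ} F_ρ)` exposed by `w` is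
net-first-order, `e = ∑ j_ρ • p_ρ` with `∑ j_ρ ≤ n`, unless the pivots carry an additive
resonance `∑ Δ_ρ p_ρ = 0`, `Δ ≠ 0`, `∑ |Δ_ρ| ≤ 2n`. [folklore] -/
theorem stub_resonanceDichotomy : ∀ (n r : ℕ) (F : Fin r → MvPolynomial (Fin 2) ℂ) (a a' : Fin n → Fin r → ℂ)
    (p : Fin r → (Fin 2 →₀ ℕ)) (w : Fin 2 → ℤ) (e : Fin 2 →₀ ℕ), 0 < w 0 → 0 < w 1 →
    (∀ ρ, MvPolynomial.coeff 0 (F ρ) = 0) → Function.Injective p →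
    (∀ ρ, p ρ ∈ (F ρ).support ∧ ∀ q ∈ (F ρ).support, q ≠ p ρ →
      w 0 * (p ρ 0 : ℤ) + w 1 * (p ρ 1 : ℤ) < w 0 * (q 0 : ℤ) + w 1 * (q 1 : ℤ) ∨
        (w 0 * (p ρ 0 : ℤ) + w 1 * (p ρ 1 : ℤ) = w 0 * (q 0 : ℤ) + w 1 * (q 1 : ℤ) ∧ p ρ 0 < q 0)) →
    (e ∈ ((∏ i, (1 + ∑ ρ, MvPolynomial.C (a i ρ) * F ρ)) - ∏ i, (1 + ∑ ρ, MvPolynomial.C (a' i ρ) * F ρ)).support ∧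
      ∀ e' ∈ ((∏ i, (1 + ∑ ρ, MvPolynomial.C (a i ρ) * F ρ)) - ∏ i, (1 + ∑ ρ, MvPolynomial.C (a' i ρ) * F ρ)).support,
        e' ≠ e → w 0 * (e 0 : ℤ) + w 1 * (e 1 : ℤ) < w 0 * (e' 0 : ℤ) + w 1 * (e' 1 : ℤ)) →
    (∃ j : Fin r → ℕ, (∑ ρ, j ρ) ≤ n ∧ e = ∑ ρ, j ρ • p ρ) ∨
      (∃ Δ : Fin r → ℤ, (∃ ρ, Δ ρ ≠ 0) ∧ (∑ ρ, |Δ ρ|) ≤ 2 * n ∧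
        (∑ ρ, Δ ρ * (p ρ 0 : ℤ)) = 0 ∧ (∑ ρ, Δ ρ * (p ρ 1 : ℤ)) = 0) := by
  intro n r F a a' p w e _ hw1 _ _ hpiv he
  obtain ⟨he, hmin⟩ := he
  classical
  -- the net polynomial `P`, with `D = P(F) = ∑_s P_s • ∏ ρ, F ρ ^ s ρ`
  obtain ⟨P, hP⟩ : ∃ P : MvPolynomial (Fin r) ℂ,
      P = (∏ i, (1 + ∑ ρ, C (a i ρ) * X ρ)) - ∏ i, (1 + ∑ ρ, C (a' i ρ) * X ρ) := ⟨_, rfl⟩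
  have hN : ∀ s ∈ P.support, (∑ ρ, s ρ) ≤ n := fun s hs =>
    sum_le_of_mem_support_net n r a a' P hP s hs
  have h1 : aeval F P =
      (∏ i, (1 + ∑ ρ, C (a i ρ) * F ρ)) - ∏ i, (1 + ∑ ρ, C (a' i ρ) * F ρ) := by
    rw [hP]
    simp only [map_sub, map_prod, map_add, map_one, map_sum, map_mul, aeval_C, aeval_X,
      algebraMap_eq]
  have hD : (∏ i, (1 + ∑ ρ, C (a i ρ) * F ρ)) - ∏ i, (1 + ∑ ρ, C (a' i ρ) * F ρ) =
      ∑ s ∈ P.support, coeff s P • ∏ ρ, F ρ ^ (s ρ) := by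
    rw [← h1, aeval_def, eval₂_eq']
    refine Finset.sum_congr rfl fun s _ => ?_
    rw [algebraMap_eq, smul_eq_C_mul]
  rcases vertex_dichotomy n F p P _ hN hD w hw1.ne' hpiv e he hmin with
    ⟨s, hs, hse⟩ | ⟨s, hs, s', hs', hne, heq⟩
  · exact Or.inl ⟨fun ρ => s ρ, hN s hs, hse⟩
  · refine Or.inr ⟨fun ρ => ((s ρ : ℕ) : ℤ) - ((s' ρ : ℕ) : ℤ), ?_, ?_, ?_, ?_⟩
    · by_contra hall
      push Not at hall
      apply hne
      ext ρ
      have h2 := hall ρ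
      omega
    · calc ∑ ρ, |((s ρ : ℕ) : ℤ) - ((s' ρ : ℕ) : ℤ)|
          ≤ ∑ ρ, (((s ρ : ℕ) : ℤ) + ((s' ρ : ℕ) : ℤ)) :=
            Finset.sum_le_sum fun ρ _ => abs_le.mpr ⟨by omega, by omega⟩
        _ = ((∑ ρ, s ρ : ℕ) : ℤ) + ((∑ ρ, s' ρ : ℕ) : ℤ) := by
            push_cast
            exact Finset.sum_add_distrib
        _ ≤ n + n := add_le_add (by exact_mod_cast hN s hs) (by exact_mod_cast hN s' hs')
        _ = 2 * n := by ring
    · have h0 := congrArg (fun q : Fin 2 →₀ ℕ => ((q 0 : ℕ) : ℤ)) heq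
      simp only [Finsupp.finsetSum_apply, Finsupp.smul_apply, smul_eq_mul, Nat.cast_sum,
        Nat.cast_mul] at h0
      simp only [sub_mul, Finset.sum_sub_distrib, h0, sub_self]
    · have h0 := congrArg (fun q : Fin 2 →₀ ℕ => ((q 1 : ℕ) : ℤ)) heq
      simp only [Finsupp.finsetSum_apply, Finsupp.smul_apply, smul_eq_mul, Nat.cast_sum,
        Nat.cast_mul] at h0
      simp only [sub_mul, Finset.sum_sub_distrib, h0, sub_self]

end Summit.ValiantsHypothesis.ValiantsHypothesis.Theorems.TwoProducts.ResonanceDichotomy
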